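import Mathlib
import HarnessLib

/-!
# Crux `EfficiencyFloor.ProductionEfficiencyDecay` (stmt-NavierStokesRegularity-22866): the scalar clauses carried by
# the registered stub `stub_depletionGivenBudget` — even together with the ENERGY CLASS, the palinstrophy-ratio
# budget, blow-up and the super-Leray MEAN law — do not imply its conclusion: an explicit budget triple

Helper file (`--supports stmt-NavierStokesRegularity-22866`; line `efficiency_floor`; Mathlib-only, route-independent).
Companion and SHARPENING of `…ProductionEfficiencyDecayMeanFormSeparation` (p825300). That file exhibits one real curve
with `Ż ≤ 4Z³`, `Z → ∞` and the mean law but not the pointwise law; its curve `Z ∼ (1−t)⁻¹` is NOT in the energy class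
(`∫ Z = ∞`, whereas a Leray–Hopf solution has `2ν∫₀ᵀ Z ≤ ‖u₀‖₂²`) and it carries no budget triple `(Z, Pal, S)`. Here,
for EVERY envelope constant `c > 0` and EVERY viscosity `ν > 0` — i.e. for exactly the quantifier prefix of the
registered crux-proper stub S2 — one explicit triple on `[0,1)`,

  `Z = μ²·z`, `Pal = μ²·z³`, `S = (Ż + 2ν·Pal)/2`, `z(t) = (2 + sin(ℓ³/3))·ℓ/√(1−t)`, `ℓ = 1 − log(1−t)`,
  `μ = (11/4 + ν)/c`,

satisfies ALL of: every scalar clause of S2's hypothesis (`0 < Z`, `0 ≤ Pal`, `HasDerivAt Z (2S − 2ν·Pal)`,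
`|S| ≤ c·Z^{3/4}·Pal^{3/4}`); blow-up `Z → ∞`; the ENERGY CLASS `∫₀ˢ Z ≤ 18μ²` for all `s < 1`; the palinstrophy-ratio
budget `∫₀ˢ Pal/Z² ≤ 18/μ²` (for a flow: `ν∫Pal/Z² ≤ Z(0)⁻¹ + C∫Z/ν³`, from `Ż + ν·Pal ≤ CZ³/ν³` divided by `Z²`); the
super-Leray MEAN law `Z(s)⁻² ≤ ε(1−s)` eventually for every `ε`; and yet NOT the pointwise law: `Ż ≥ Z³/(8μ⁴)` at the
instants `ℓ³/3 ∈ 2πℕ`, which accumulate at `1` (`scalarBarrier`). The efficiency `Ż/Z³` oscillates with amplitude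
`≍ μ⁻⁴` on the clock `ℓ³`, slower than any power of `(1−t)⁻¹` — compatible with the cubic law, integrability and the
mean law at once.

READING. Any proof of S2 (equivalently of the crux, `…Reduction`, p585755) must use an input that is not a scalar
functional inequality between `Z`, `Pal`, `S` of the listed kinds — e.g. the spatial structure behind the UPGRADE factor
U of `…FrequentDepletion` (no late oscillation of the Lu–Doering efficiency). This is a statement about explicit real
functions; nothing about Navier–Stokes is asserted; stmt-22866 and NS regularity stay OPEN. [folklore]
-/

-- the problem directory repeats the summit name (`NavierStokesRegularity/NavierStokesRegularity`)
set_option linter.dupNamespace false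

noncomputable section

namespace Summit.NavierStokesRegularity.NavierStokesRegularity.Theorems

namespace ProductionEfficiencyDecay

namespace ScalarBarrier

open Set Filter Topology Real MeasureTheory intervalIntegral

/-! ### §1 The model curve: positivity facts, derivative, envelope -/

/-- On `[0,1)`: `0 < 1 − t ≤ 1`, `0 < √(1−t) ≤ 1`, `(√(1−t))² = 1 − t`, and `1 ≤ ℓ = 1 − log(1−t)`. [folklore] -/
theorem basic {t : ℝ} (ht : t ∈ Ico (0 : ℝ) 1) :
    0 < 1 - t ∧ 1 - t ≤ 1 ∧ 0 < Real.sqrt (1 - t) ∧ Real.sqrt (1 - t) ≤ 1 ∧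
      Real.sqrt (1 - t) ^ 2 = 1 - t ∧ 1 ≤ 1 - Real.log (1 - t) := by
  have h1 : 0 < 1 - t := by linarith [ht.2]
  have h2 : 1 - t ≤ 1 := by linarith [ht.1]
  refine ⟨h1, h2, Real.sqrt_pos.2 h1, (Real.sqrt_le_sqrt h2).trans_eq Real.sqrt_one,
    Real.sq_sqrt h1.le, ?_⟩
  have : Real.log (1 - t) ≤ 0 := Real.log_nonpos h1.le h2
  linarith

/-- Derivative of `ℓ(t) = 1 − log(1−t)`: `ℓ' = (1−t)⁻¹` for `t < 1`. [folklore] -/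
theorem hasDerivAt_ell {t : ℝ} (ht : t < 1) :
    HasDerivAt (fun s : ℝ => 1 - Real.log (1 - s)) (1 / (1 - t)) t := by
  have h1 : HasDerivAt (fun s : ℝ => 1 - s) (-1) t := by
    simpa using (hasDerivAt_id t).const_sub 1
  have hne : (1 : ℝ) - t ≠ 0 := (sub_pos.2 ht).ne'
  refine ((hasDerivAt_const t (1 : ℝ)).sub (h1.log hne)).congr_deriv ?_
  ring

/-- Derivative of the model curve `z(t) = (2 + sin(ℓ³/3))·ℓ/√(1−t)`, `ℓ = 1 − log(1−t)`, for `t < 1`: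
`ż = (ℓ³ cos(ℓ³/3) + (2 + sin(ℓ³/3))(1 + ℓ/2)) / (√(1−t))³`. [folklore] -/
theorem hasDerivAt_model {t : ℝ} (ht : t < 1) :
    HasDerivAt
      (fun s : ℝ => (2 + Real.sin ((1 - Real.log (1 - s)) ^ 3 / 3)) * (1 - Real.log (1 - s)) /
        Real.sqrt (1 - s))
      (((1 - Real.log (1 - t)) ^ 3 * Real.cos ((1 - Real.log (1 - t)) ^ 3 / 3) +
          (2 + Real.sin ((1 - Real.log (1 - t)) ^ 3 / 3)) * (1 + (1 - Real.log (1 - t)) / 2)) /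
        Real.sqrt (1 - t) ^ 3) t := by
  have hpos : 0 < 1 - t := sub_pos.2 ht
  have h1 : HasDerivAt (fun s : ℝ => 1 - s) (-1) t := by
    simpa using (hasDerivAt_id t).const_sub 1
  have hℓ := hasDerivAt_ell ht
  have hφ : HasDerivAt (fun s : ℝ => (1 - Real.log (1 - s)) ^ 3 / 3)
      (((3 : ℕ) : ℝ) * (1 - Real.log (1 - t)) ^ (3 - 1) * (1 / (1 - t)) / 3) t :=
    (hℓ.pow 3).div_const 3
  have hA : HasDerivAt (fun s : ℝ => 2 + Real.sin ((1 - Real.log (1 - s)) ^ 3 / 3))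
      (Real.cos ((1 - Real.log (1 - t)) ^ 3 / 3) *
        (((3 : ℕ) : ℝ) * (1 - Real.log (1 - t)) ^ (3 - 1) * (1 / (1 - t)) / 3)) t :=
    hφ.sin.const_add 2
  have hnum : HasDerivAt
      (fun s : ℝ => (2 + Real.sin ((1 - Real.log (1 - s)) ^ 3 / 3)) * (1 - Real.log (1 - s)))
      (Real.cos ((1 - Real.log (1 - t)) ^ 3 / 3) *
        (((3 : ℕ) : ℝ) * (1 - Real.log (1 - t)) ^ (3 - 1) * (1 / (1 - t)) / 3) * (1 - Real.log (1 - t)) +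
        (2 + Real.sin ((1 - Real.log (1 - t)) ^ 3 / 3)) * (1 / (1 - t))) t :=
    hA.mul hℓ
  have hw : HasDerivAt (fun s : ℝ => Real.sqrt (1 - s)) ((-1) / (2 * Real.sqrt (1 - t))) t :=
    h1.sqrt hpos.ne'
  have hwne : Real.sqrt (1 - t) ≠ 0 := (Real.sqrt_pos.2 hpos).ne'
  refine (hnum.div hw hwne).congr_deriv ?_
  set w : ℝ := Real.sqrt (1 - t) with hw_def
  set ℓ : ℝ := 1 - Real.log (1 - t) with hℓ_def
  have hw2 : w ^ 2 = 1 - t := by rw [hw_def]; exact Real.sq_sqrt hpos.le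
  have hwpos : 0 < w := Real.sqrt_pos.2 hpos
  rw [← hw2]
  norm_num
  field_simp
  ring

/-- Algebraic envelope: for `1 ≤ ℓ`, `0 < w`, `σ, κ ∈ [−1,1]`:
`|(ℓ³κ + (2+σ)(1+ℓ/2))/w³| ≤ (11/2)·((2+σ)ℓ/w)³`. [folklore] -/
theorem envelope {ℓ w σ κ : ℝ} (hℓ : 1 ≤ ℓ) (hw : 0 < w) (hσ₁ : -1 ≤ σ) (hσ₂ : σ ≤ 1)
    (hκ₁ : -1 ≤ κ) (hκ₂ : κ ≤ 1) :
    |(ℓ ^ 3 * κ + (2 + σ) * (1 + ℓ / 2)) / w ^ 3| ≤ 11 / 2 * ((2 + σ) * ℓ / w) ^ 3 := by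
  have hℓ0 : 0 ≤ ℓ := by linarith
  have hℓ3 : 0 ≤ ℓ ^ 3 := by positivity
  have hw3 : 0 < w ^ 3 := by positivity
  have hnum : |ℓ ^ 3 * κ + (2 + σ) * (1 + ℓ / 2)| ≤ 11 / 2 * ℓ ^ 3 := by
    have hℓ31 : ℓ ≤ ℓ ^ 3 := le_self_pow₀ hℓ (by norm_num)
    have h13 : (1 : ℝ) ≤ ℓ ^ 3 := one_le_pow₀ hℓ
    rw [abs_le]
    constructor <;> nlinarith [mul_nonneg hℓ3 (show 0 ≤ κ + 1 by linarith),
      mul_nonneg hℓ3 (show 0 ≤ 1 - κ by linarith)]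
  have hcube : ℓ ^ 3 ≤ ((2 + σ) * ℓ) ^ 3 := by
    rw [mul_pow]
    have : (1 : ℝ) ≤ (2 + σ) ^ 3 := one_le_pow₀ (by linarith)
    nlinarith
  rw [abs_div, abs_of_pos hw3, div_pow, div_le_iff₀ hw3]
  rw [show 11 / 2 * (((2 + σ) * ℓ) ^ 3 / w ^ 3) * w ^ 3 = 11 / 2 * ((2 + σ) * ℓ) ^ 3 by
    field_simp]
  nlinarith

/-- **Budget exponents**: `(μ²x)^{3/4} (μ²x³)^{3/4} = μ³x³` for `μ > 0`, `x ≥ 0`. [folklore] -/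
theorem rpow_budget {μ x : ℝ} (hμ : 0 < μ) (hx : 0 ≤ x) :
    (μ ^ 2 * x) ^ (3 / 4 : ℝ) * (μ ^ 2 * x ^ 3) ^ (3 / 4 : ℝ) = μ ^ 3 * x ^ 3 := by
  rw [← Real.mul_rpow (by positivity) (by positivity)]
  have h4 : μ ^ 2 * x * (μ ^ 2 * x ^ 3) = (μ * x) ^ (4 : ℕ) := by ring
  rw [h4, ← Real.rpow_natCast _ 4, ← Real.rpow_mul (by positivity)]
  norm_num
  ring

/-! ### §2 Size of the model curve and its integral (the energy class) -/

/-- On `[0,1)` the model curve `z = (2 + sin(ℓ³/3))·ℓ/√(1−t)` satisfies `0 < z`, `ℓ/√(1−t) ≤ z ≤ 3ℓ/√(1−t)` and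
`1/√(1−t) ≤ ℓ/√(1−t)`. [folklore] -/
theorem model_bounds {t : ℝ} (ht : t ∈ Ico (0 : ℝ) 1) :
    0 < ((2 + Real.sin ((1 - Real.log (1 - t)) ^ 3 / 3)) * (1 - Real.log (1 - t)) / Real.sqrt (1 - t)) ∧
      (1 - Real.log (1 - t)) / Real.sqrt (1 - t) ≤ ((2 + Real.sin ((1 - Real.log (1 - t)) ^ 3 / 3)) * (1 - Real.log (1 - t)) / Real.sqrt (1 - t)) ∧
      ((2 + Real.sin ((1 - Real.log (1 - t)) ^ 3 / 3)) * (1 - Real.log (1 - t)) / Real.sqrt (1 - t)) ≤ 3 * ((1 - Real.log (1 - t)) / Real.sqrt (1 - t)) ∧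
      1 / Real.sqrt (1 - t) ≤ (1 - Real.log (1 - t)) / Real.sqrt (1 - t) := by
  obtain ⟨-, -, hwpos, -, -, hℓ1⟩ := basic ht
  set ℓ : ℝ := 1 - Real.log (1 - t) with hℓ_def
  set w : ℝ := Real.sqrt (1 - t) with hw_def
  have hσ₁ : -1 ≤ Real.sin (ℓ ^ 3 / 3) := Real.neg_one_le_sin _
  have hσ₂ : Real.sin (ℓ ^ 3 / 3) ≤ 1 := Real.sin_le_one _
  have hℓ0 : 0 < ℓ := by linarith
  have hq : 0 < ℓ / w := div_pos hℓ0 hwpos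
  refine ⟨?_, ?_, ?_, ?_⟩
  · rw [mul_div_assoc]; exact mul_pos (by linarith) hq
  · rw [mul_div_assoc]; nlinarith
  · rw [mul_div_assoc]; nlinarith
  · exact div_le_div_of_nonneg_right hℓ1 hwpos.le

/-- Antiderivative for the energy bound: `F(t) = −2√(1−t)·(3 − log(1−t))` has `F' = ℓ/√(1−t)`, `t < 1`. [folklore] -/
theorem hasDerivAt_prim {t : ℝ} (ht : t < 1) :
    HasDerivAt (fun s : ℝ => -2 * Real.sqrt (1 - s) * (3 - Real.log (1 - s)))
      ((1 - Real.log (1 - t)) / Real.sqrt (1 - t)) t := by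
  have hpos : 0 < 1 - t := sub_pos.2 ht
  have h1 : HasDerivAt (fun s : ℝ => 1 - s) (-1) t := by
    simpa using (hasDerivAt_id t).const_sub 1
  have hw : HasDerivAt (fun s : ℝ => Real.sqrt (1 - s)) ((-1) / (2 * Real.sqrt (1 - t))) t :=
    h1.sqrt hpos.ne'
  have hL : HasDerivAt (fun s : ℝ => 3 - Real.log (1 - s)) (0 - (-1) / (1 - t)) t :=
    (hasDerivAt_const t (3 : ℝ)).sub (h1.log hpos.ne')
  refine ((hw.const_mul (-2)).mul hL).congr_deriv ?_
  set w : ℝ := Real.sqrt (1 - t) with hw_def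
  have hw2 : w ^ 2 = 1 - t := by rw [hw_def]; exact Real.sq_sqrt hpos.le
  have hwpos : 0 < w := Real.sqrt_pos.2 hpos
  rw [← hw2]
  field_simp
  ring

/-- Continuity of the model curve and of `ℓ/√(1−t)` on `[0,s]`, `s < 1` (both are differentiable there). [folklore] -/
theorem continuousOn_model {s : ℝ} (hs : s < 1) :
    ContinuousOn (fun t : ℝ => ((2 + Real.sin ((1 - Real.log (1 - t)) ^ 3 / 3)) * (1 - Real.log (1 - t)) / Real.sqrt (1 - t))) (uIcc 0 s) ∧
      ContinuousOn (fun t : ℝ => (1 - Real.log (1 - t)) / Real.sqrt (1 - t)) (uIcc 0 s) := by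
  have hlt : ∀ x ∈ uIcc (0 : ℝ) s, x < 1 := fun x hx => by
    rcases le_total 0 s with h | h
    · rw [uIcc_of_le h] at hx; exact hx.2.trans_lt hs
    · rw [uIcc_of_ge h] at hx; exact hx.2.trans_lt zero_lt_one
  refine ⟨fun x hx => (hasDerivAt_model (hlt x hx)).continuousAt.continuousWithinAt, fun x hx => ?_⟩
  have hx1 := hlt x hx
  have h1 : HasDerivAt (fun s : ℝ => 1 - s) (-1) x := by
    simpa using (hasDerivAt_id x).const_sub 1
  exact ((hasDerivAt_ell hx1).div (h1.sqrt (sub_pos.2 hx1).ne')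
    (Real.sqrt_pos.2 (sub_pos.2 hx1)).ne').continuousAt.continuousWithinAt

/-- **Energy class**: `∫₀ˢ z ≤ 18` for every `s ∈ [0,1)` (`z ≤ 3ℓ/√(1−t)` and `∫₀ˢ ℓ/√(1−t) = 6 − 2√(1−s)(3 − log(1−s)) ≤ 6`).
[folklore] -/
theorem integral_model_le {s : ℝ} (hs : s ∈ Ico (0 : ℝ) 1) :
    ∫ t in (0 : ℝ)..s, ((2 + Real.sin ((1 - Real.log (1 - t)) ^ 3 / 3)) * (1 - Real.log (1 - t)) / Real.sqrt (1 - t)) ≤ 18 := by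
  obtain ⟨hcz, hcq⟩ := continuousOn_model hs.2
  have hprim : ∫ t in (0 : ℝ)..s, (1 - Real.log (1 - t)) / Real.sqrt (1 - t) ≤ 6 := by
    have hderiv : ∀ x ∈ uIcc (0 : ℝ) s,
        HasDerivAt (fun s : ℝ => -2 * Real.sqrt (1 - s) * (3 - Real.log (1 - s)))
          ((1 - Real.log (1 - x)) / Real.sqrt (1 - x)) x := by
      intro x hx
      rw [uIcc_of_le hs.1] at hx
      exact hasDerivAt_prim (hx.2.trans_lt hs.2)
    rw [integral_eq_sub_of_hasDerivAt hderiv hcq.intervalIntegrable]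
    obtain ⟨h1, h2, hwpos, -, -, -⟩ := basic hs
    have hlog : Real.log (1 - s) ≤ 0 := Real.log_nonpos h1.le h2
    simp only [sub_zero, Real.log_one, Real.sqrt_one]
    nlinarith [mul_nonneg hwpos.le (show (0 : ℝ) ≤ 3 - Real.log (1 - s) by linarith)]
  calc ∫ t in (0 : ℝ)..s, ((2 + Real.sin ((1 - Real.log (1 - t)) ^ 3 / 3)) * (1 - Real.log (1 - t)) / Real.sqrt (1 - t))
      ≤ ∫ t in (0 : ℝ)..s, 3 * ((1 - Real.log (1 - t)) / Real.sqrt (1 - t)) :=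
        integral_mono_on hs.1 hcz.intervalIntegrable (hcq.intervalIntegrable.const_mul 3)
          fun x hx => (model_bounds ⟨hx.1, hx.2.trans_lt hs.2⟩).2.2.1
    _ = 3 * ∫ t in (0 : ℝ)..s, (1 - Real.log (1 - t)) / Real.sqrt (1 - t) :=
        intervalIntegral.integral_const_mul _ _
    _ ≤ 18 := by linarith

/-! ### §3 The barrier triple -/

/-- **SCALAR BARRIER for the registered stub `stub_depletionGivenBudget` (crux stmt-22866).** For every envelope
constant `c > 0` and viscosity `ν > 0` there are real functions `Z, Pal, S, D` on `[0,1)` with: `0 < Z`, `0 ≤ Pal`,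
`HasDerivAt Z D`, `D = 2S − 2ν·Pal`, `|S| ≤ c·Z^{3/4}·Pal^{3/4}` (every scalar clause of the stub's hypothesis);
blow-up `Z → ∞`; the ENERGY CLASS `∫₀ˢ Z ≤ E`; the palinstrophy-ratio budget `∫₀ˢ Pal/Z² ≤ E'`; the super-Leray MEAN law
`Z(s)⁻² ≤ ε(1−s)` eventually for every `ε > 0`; and NOT the pointwise law `D ≤ εZ³` eventually for every `ε > 0`
(it fails for `ε = 1/(16μ⁴)` at instants accumulating at `1`). Witness: `Z = μ²(2 + sin(ℓ³/3))ℓ/√(1−t)`,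
`ℓ = 1 − log(1−t)`, `μ = (11/4 + ν)/c`, `Pal = Z³/μ⁴`, `S = (Ż + 2ν·Pal)/2`. A statement about explicit real functions;
nothing about Navier–Stokes is asserted. [folklore] -/
theorem scalarBarrier (c ν : ℝ) (hc : 0 < c) (hν : 0 < ν) :
    ∃ Z P S D : ℝ → ℝ,
      (∀ t ∈ Ico (0 : ℝ) 1, 0 < Z t ∧ 0 ≤ P t ∧ HasDerivAt Z (D t) t ∧ D t = 2 * S t - 2 * ν * P t ∧
          |S t| ≤ c * Z t ^ (3 / 4 : ℝ) * P t ^ (3 / 4 : ℝ)) ∧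
      (∀ N : ℝ, ∃ t₁ ∈ Ico (0 : ℝ) 1, ∀ t ∈ Ico t₁ 1, N ≤ Z t) ∧
      (∃ E : ℝ, ∀ s ∈ Ico (0 : ℝ) 1, ∫ t in (0 : ℝ)..s, Z t ≤ E) ∧
      (∃ E' : ℝ, ∀ s ∈ Ico (0 : ℝ) 1, ∫ t in (0 : ℝ)..s, P t / Z t ^ 2 ≤ E') ∧
      (∀ ε : ℝ, 0 < ε → ∃ t₁ ∈ Ico (0 : ℝ) 1, ∀ s ∈ Ico t₁ 1, (Z s)⁻¹ ^ 2 ≤ ε * (1 - s)) ∧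
      ¬ (∀ ε : ℝ, 0 < ε → ∃ t₁ ∈ Ico (0 : ℝ) 1, ∀ t ∈ Ico t₁ 1, D t ≤ ε * Z t ^ 3) := by
  obtain ⟨μ, hμ, hμc⟩ : ∃ μ : ℝ, 0 < μ ∧ c * μ = 11 / 4 + ν :=
    ⟨(11 / 4 + ν) / c, by positivity, by field_simp⟩
  refine ⟨fun t => μ ^ 2 * ((2 + Real.sin ((1 - Real.log (1 - t)) ^ 3 / 3)) * (1 - Real.log (1 - t)) / Real.sqrt (1 - t)), fun t => μ ^ 2 * ((2 + Real.sin ((1 - Real.log (1 - t)) ^ 3 / 3)) * (1 - Real.log (1 - t)) / Real.sqrt (1 - t)) ^ 3,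
    fun t => (μ ^ 2 * (((1 - Real.log (1 - t)) ^ 3 * Real.cos ((1 - Real.log (1 - t)) ^ 3 / 3) + (2 + Real.sin ((1 - Real.log (1 - t)) ^ 3 / 3)) * (1 + (1 - Real.log (1 - t)) / 2)) / Real.sqrt (1 - t) ^ 3) + 2 * ν * (μ ^ 2 * ((2 + Real.sin ((1 - Real.log (1 - t)) ^ 3 / 3)) * (1 - Real.log (1 - t)) / Real.sqrt (1 - t)) ^ 3)) / 2, fun t => μ ^ 2 * (((1 - Real.log (1 - t)) ^ 3 * Real.cos ((1 - Real.log (1 - t)) ^ 3 / 3) + (2 + Real.sin ((1 - Real.log (1 - t)) ^ 3 / 3)) * (1 + (1 - Real.log (1 - t)) / 2)) / Real.sqrt (1 - t) ^ 3),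
    ?_, ?_, ?_, ?_, ?_, ?_⟩
  · -- the scalar clauses of the registered stub
    intro t ht
    have hD := (hasDerivAt_model ht.2).const_mul (μ ^ 2)
    obtain ⟨-, -, hwpos, -, -, hℓ1⟩ := basic ht
    have hz := (model_bounds ht).1
    set ℓ : ℝ := 1 - Real.log (1 - t) with hℓ_def
    set w : ℝ := Real.sqrt (1 - t) with hw_def
    set σ : ℝ := Real.sin (ℓ ^ 3 / 3) with hσ_def
    set κ : ℝ := Real.cos (ℓ ^ 3 / 3) with hκ_def
    have hσ₁ : -1 ≤ σ := Real.neg_one_le_sin _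
    have hσ₂ : σ ≤ 1 := Real.sin_le_one _
    have hκ₁ : -1 ≤ κ := Real.neg_one_le_cos _
    have hκ₂ : κ ≤ 1 := Real.cos_le_one _
    set x : ℝ := (2 + σ) * ℓ / w with hx_def
    have hμ2 : 0 ≤ μ ^ 2 := sq_nonneg μ
    have hx3 : 0 ≤ x ^ 3 := pow_nonneg hz.le 3
    refine ⟨mul_pos (pow_pos hμ 2) hz, mul_nonneg hμ2 hx3, hD, by ring, ?_⟩
    have hdz : |(ℓ ^ 3 * κ + (2 + σ) * (1 + ℓ / 2)) / w ^ 3| ≤ 11 / 2 * x ^ 3 :=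
      envelope hℓ1 hwpos hσ₁ hσ₂ hκ₁ hκ₂
    obtain ⟨hlo, hup⟩ := abs_le.1 hdz
    have hup' := mul_le_mul_of_nonneg_left hup hμ2
    have hlo' := mul_le_mul_of_nonneg_left hlo hμ2
    rw [mul_assoc c, rpow_budget hμ hz.le]
    have hkey : c * (μ ^ 3 * x ^ 3) = μ ^ 2 * (11 / 4 + ν) * x ^ 3 := by rw [← hμc]; ring
    rw [hkey, abs_le]
    constructor <;> nlinarith [mul_nonneg hμ2 hx3]
  · -- blow-up
    intro N
    rcases le_or_gt N 0 with hN | hN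
    · refine ⟨0, ⟨le_rfl, zero_lt_one⟩, fun t ht => hN.trans ?_⟩
      exact (mul_pos (pow_pos hμ 2) (model_bounds ⟨ht.1, ht.2⟩).1).le
    have hr : 0 < (μ ^ 2 / N) ^ 2 := by positivity
    refine ⟨max 0 (1 - (μ ^ 2 / N) ^ 2), ⟨le_max_left _ _, max_lt zero_lt_one (by linarith)⟩,
      fun t ht => ?_⟩
    have ht0 : 0 ≤ t := (le_max_left _ _).trans ht.1
    have ht' : t ∈ Ico (0 : ℝ) 1 := ⟨ht0, ht.2⟩
    obtain ⟨h1, -, hwpos, -, -, -⟩ := basic ht'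
    obtain ⟨hz, hq, -, h1w⟩ := model_bounds ht'
    have hle : 1 - t ≤ (μ ^ 2 / N) ^ 2 := by linarith [(le_max_right _ _).trans ht.1]
    have hw : Real.sqrt (1 - t) ≤ μ ^ 2 / N := by
      rw [← Real.sqrt_sq (by positivity : (0 : ℝ) ≤ μ ^ 2 / N)]
      exact Real.sqrt_le_sqrt hle
    have hNw : N ≤ μ ^ 2 * (1 / Real.sqrt (1 - t)) := by
      rw [mul_one_div, le_div_iff₀ hwpos]
      calc N * Real.sqrt (1 - t) ≤ N * (μ ^ 2 / N) := mul_le_mul_of_nonneg_left hw hN.le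
        _ = μ ^ 2 := by field_simp
    exact hNw.trans (mul_le_mul_of_nonneg_left (h1w.trans hq) (sq_nonneg μ))
  · -- energy class
    refine ⟨18 * μ ^ 2, fun s hs => ?_⟩
    rw [intervalIntegral.integral_const_mul]
    nlinarith [integral_model_le hs, sq_nonneg μ]
  · -- palinstrophy-ratio budget
    refine ⟨18 / μ ^ 2, fun s hs => ?_⟩
    have heq : EqOn (fun t : ℝ => μ ^ 2 * ((2 + Real.sin ((1 - Real.log (1 - t)) ^ 3 / 3)) * (1 - Real.log (1 - t)) / Real.sqrt (1 - t)) ^ 3 / (μ ^ 2 * ((2 + Real.sin ((1 - Real.log (1 - t)) ^ 3 / 3)) * (1 - Real.log (1 - t)) / Real.sqrt (1 - t))) ^ 2)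
        (fun t : ℝ => (1 / μ ^ 2) * ((2 + Real.sin ((1 - Real.log (1 - t)) ^ 3 / 3)) * (1 - Real.log (1 - t)) / Real.sqrt (1 - t))) (uIcc 0 s) := by
      intro t ht
      rw [uIcc_of_le hs.1] at ht
      have hz := (model_bounds ⟨ht.1, ht.2.trans_lt hs.2⟩).1
      simp only
      field_simp
    rw [integral_congr heq, intervalIntegral.integral_const_mul]
    rw [show 18 / μ ^ 2 = 1 / μ ^ 2 * 18 by ring]
    exact mul_le_mul_of_nonneg_left (integral_model_le hs) (by positivity)
  · -- super-Leray mean law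
    intro ε hε
    set M : ℝ := 1 / (μ ^ 4 * ε) + 1 with hM_def
    have hM0 : 0 < M := by positivity
    have hMε : 1 ≤ μ ^ 4 * ε * M := by
      rw [hM_def, mul_add, mul_one_div_cancel (by positivity)]
      nlinarith [mul_pos (pow_pos hμ 4) hε]
    have hexp : 0 < Real.exp (-M) := Real.exp_pos _
    have hexp1 : Real.exp (-M) ≤ 1 := Real.exp_le_one_iff.2 (by linarith)
    refine ⟨1 - Real.exp (-M), ⟨by linarith, by linarith⟩, fun s hs => ?_⟩
    have hs' : s ∈ Ico (0 : ℝ) 1 := ⟨by linarith [hs.1], hs.2⟩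
    obtain ⟨h1, -, hwpos, -, hw2, hℓ1⟩ := basic hs'
    obtain ⟨hz, hq, -, -⟩ := model_bounds hs'
    have hℓM : M ≤ 1 - Real.log (1 - s) := by
      have : Real.log (1 - s) ≤ Real.log (Real.exp (-M)) :=
        Real.log_le_log h1 (by linarith [hs.1])
      rw [Real.log_exp] at this
      linarith
    set ℓ : ℝ := 1 - Real.log (1 - s) with hℓ_def
    set w : ℝ := Real.sqrt (1 - s) with hw_def
    have hpos : 0 < μ ^ 2 * (ℓ / w) := mul_pos (pow_pos hμ 2) (div_pos (by linarith) hwpos)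
    have hZ : μ ^ 2 * (ℓ / w) ≤ μ ^ 2 * ((2 + Real.sin (ℓ ^ 3 / 3)) * ℓ / w) :=
      mul_le_mul_of_nonneg_left hq (sq_nonneg μ)
    have hℓ2 : 1 ≤ μ ^ 4 * ε * ℓ ^ 2 := by
      have : M ≤ ℓ ^ 2 := by nlinarith
      nlinarith [mul_pos (pow_pos hμ 4) hε]
    rw [inv_pow, ← one_div]
    calc 1 / (μ ^ 2 * ((2 + Real.sin (ℓ ^ 3 / 3)) * ℓ / w)) ^ 2 ≤ 1 / (μ ^ 2 * (ℓ / w)) ^ 2 :=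
          one_div_le_one_div_of_le (pow_pos hpos 2) (pow_le_pow_left₀ hpos.le hZ 2)
      _ = (1 - s) / (μ ^ 4 * ℓ ^ 2) := by
          rw [← hw2]
          field_simp
      _ ≤ ε * (1 - s) := by
          rw [div_le_iff₀ (by positivity)]
          nlinarith [mul_nonneg h1.le (sub_nonneg.2 hℓ2)]
  · -- the pointwise law fails at the instants `ℓ³/3 ∈ 2πℕ`
    intro h
    obtain ⟨t₁, ht₁, hlaw⟩ := h (1 / (16 * μ ^ 4)) (by positivity)
    obtain ⟨n, hn⟩ := exists_nat_ge ((1 - Real.log (1 - t₁)) ^ 3 / 3 / (2 * Real.pi))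
    set v : ℝ := (n : ℝ) * (2 * Real.pi) with hv_def
    have hv : (1 - Real.log (1 - t₁)) ^ 3 / 3 ≤ v := by
      rw [hv_def]; exact (div_le_iff₀ Real.two_pi_pos).1 hn
    have hexp : 0 < Real.exp (-(3 * v)) := Real.exp_pos _
    set t₂ : ℝ := max t₁ (1 - Real.exp (-(3 * v))) with ht₂_def
    have ht₁₂ : t₁ ≤ t₂ := le_max_left _ _
    have ht₂1 : t₂ < 1 := max_lt ht₁.2 (by linarith)
    have ht₂' : t₂ ∈ Ico (0 : ℝ) 1 := ⟨ht₁.1.trans ht₁₂, ht₂1⟩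
    obtain ⟨h12, -, -, -, -, hℓ1₂⟩ := basic ht₂'
    have hφ₂ : v ≤ (1 - Real.log (1 - t₂)) ^ 3 / 3 := by
      have hlog : Real.log (1 - t₂) ≤ -(3 * v) := by
        have : Real.log (1 - t₂) ≤ Real.log (Real.exp (-(3 * v))) :=
          Real.log_le_log h12 (by linarith [le_max_right t₁ (1 - Real.exp (-(3 * v)))])
        rwa [Real.log_exp] at this
      have hℓv : 3 * v ≤ 1 - Real.log (1 - t₂) := by linarith
      nlinarith [le_self_pow₀ hℓ1₂ (by norm_num : (3 : ℕ) ≠ 0)]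
    have hcont : ContinuousOn (fun s : ℝ => (1 - Real.log (1 - s)) ^ 3 / 3) (Icc t₁ t₂) := fun x hx =>
      (((hasDerivAt_ell (hx.2.trans_lt ht₂1)).pow 3).div_const 3).continuousAt.continuousWithinAt
    obtain ⟨t, htI, hφt⟩ := intermediate_value_Icc ht₁₂ hcont ⟨hv, hφ₂⟩
    have ht1 : t < 1 := htI.2.trans_lt ht₂1
    have ht' : t ∈ Ico (0 : ℝ) 1 := ⟨ht₁.1.trans htI.1, ht1⟩
    have hlt := hlaw t ⟨htI.1, ht1⟩
    simp only at hlt hφt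
    obtain ⟨-, -, hwpos, -, -, hℓ1⟩ := basic ht'
    set ℓ : ℝ := 1 - Real.log (1 - t) with hℓ_def
    set w : ℝ := Real.sqrt (1 - t) with hw_def
    have hcos : Real.cos (ℓ ^ 3 / 3) = 1 := by rw [hφt, hv_def]; exact Real.cos_nat_mul_two_pi n
    have hsin : Real.sin (ℓ ^ 3 / 3) = 0 := by
      rw [hφt, hv_def]; simpa using Real.sin_nat_mul_two_pi_sub 0 n
    rw [hcos, hsin] at hlt
    have hw3 : 0 < w ^ 3 := pow_pos hwpos 3
    have h1 : 1 / (16 * μ ^ 4) * (μ ^ 2 * ((2 + 0) * ℓ / w)) ^ 3 = μ ^ 2 * (ℓ ^ 3 / (2 * w ^ 3)) := by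
      field_simp
      ring
    have h2 : μ ^ 2 * ((ℓ ^ 3 * 1 + (2 + 0) * (1 + ℓ / 2)) / w ^ 3) =
        μ ^ 2 * (ℓ ^ 3 / (2 * w ^ 3)) + μ ^ 2 * ((ℓ ^ 3 / 2 + 2 + ℓ) / w ^ 3) := by
      field_simp
      ring
    have h3 : 0 < μ ^ 2 * ((ℓ ^ 3 / 2 + 2 + ℓ) / w ^ 3) := by positivity
    linarith

end ScalarBarrier

end ProductionEfficiencyDecay

end Summit.NavierStokesRegularity.NavierStokesRegularity.Theorems

end
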